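import Summits.ValiantsHypothesis.ValiantsHypothesis.Theorems.GrenetZeonDualUnipotentThreeHalvesHeavyTopTowerDefs
import Summits.ValiantsHypothesis.ValiantsHypothesis.Theorems.GrenetZeonDualUnipotentThreeHalvesHeavyTopInvariantFlag
import Summits.ValiantsHypothesis.ValiantsHypothesis.Theorems.GrenetZeonDualUnipotentThreeHalvesHeavyTopTorusInitial

/-!
# `GrenetZeon.DualUnipotentThreeHalves` (stmt-ValiantsHypothesis-24318), R2 heavy-top instrument — the TOWER HULL `T(p, I, q)`:
# nilpotency and NON-triangularisability (val-idea-30 MEMO codim-one COROLLARY II, small lemmas; director R504-htc (2)(b))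

For `I ≤ M₃(ℂ)` a space of nilpotent matrices, every member of the tower hull `towerHull p q I` (✓ `…HeavyTopTowerDefs`) is nilpotent
(block upper-triangular with nilpotent diagonal blocks); and if `I` acts IRREDUCIBLY on `ℂ³` (no invariant subspace other than `0`, `ℂ³` — the
`hirr` shape of ✓ `iota_le`), the tower hull is NOT simultaneously strictly upper triangularisable: its invariant subspaces have dimension in
`[0, p] ∪ [p+3, p+3+q]`, so no conjugate of it sits inside `𝔫` (which would give an invariant subspace of dimension `p + 1`).

* `pow_apply_eq_zero_of_strictUpper_fun` — a matrix vanishing on `f j ≤ f i` has `k`-th power vanishing on `f j < f i + k`;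
* ★ `isNilpotent_of_mem_towerHull` — members of `T(p, I, q)` are nilpotent when `I` is;
* `single_mem_towerHull`, `middle_mem_towerHull` — the matrix units of the free blocks and the middle embedding `diag(0, X, 0)`, `X ∈ I`, lie in the hull;
* ★ `not_strictUpper_conj_towerHull` — for irreducible `I`, no invertible `P` makes all of `T(p, I, q)` strictly upper triangular.

(The dimension count `finrank (towerHull p q I) = C(p+3+q, 2) − 3 + finrank I` and the classification theorem are the successor's files.)
Honest framing: structure lemmas; nothing here proves or refutes `HeavyTopLaw`, 24318, S3b or 8062; `VP ≠ VNP` is NOT proved.  No definitions.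
[val-idea-30 MEMO codim-one §4 (ii)–(iii); this seat]
-/

noncomputable section

-- single-conjunct layout: Sub = Summit, duplicated namespace component intended
set_option linter.dupNamespace false

namespace Summit.ValiantsHypothesis.ValiantsHypothesis.Theorems.GrenetZeon.HeavyTopTowerLemmas

open Matrix
open Summit.ValiantsHypothesis.ValiantsHypothesis.Theorems.GrenetZeon.HeavyTopTowerDefs
open Summit.ValiantsHypothesis.ValiantsHypothesis.Theorems.GrenetZeon.HeavyTopInvariantFlag (blockUpper_mul toBlock_pow_of_blockUpper)
open Summit.ValiantsHypothesis.ValiantsHypothesis.Theorems.GrenetZeon.HeavyTopTorusInitial (pow_eq_zero_of_isNilpotent)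

/-! ## Strictly upper triangular matrices on a graded index type are nilpotent -/

/-- If `B i j = 0` whenever `f j ≤ f i`, then `(B^k) i j = 0` whenever `f j < f i + k`. [folklore] -/
theorem pow_apply_eq_zero_of_strictUpper_fun {ι : Type*} [Fintype ι] [DecidableEq ι] (f : ι → ℕ) (B : Matrix ι ι ℂ)
    (hB : ∀ i j, f j ≤ f i → B i j = 0) : ∀ k : ℕ, ∀ i j, f j < f i + k → (B ^ k) i j = 0
  | 0 => fun i j h => by rw [pow_zero, Matrix.one_apply, if_neg]; rintro rfl; omega
  | k + 1 => by
    intro i j h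
    rw [pow_succ, Matrix.mul_apply]
    refine Finset.sum_eq_zero fun l _ => ?_
    by_cases hl : f l < f i + k
    · rw [pow_apply_eq_zero_of_strictUpper_fun f B hB k i l hl, zero_mul]
    · rw [hB l j (by omega), mul_zero]

/-! ## Members of the tower hull are nilpotent -/

set_option maxHeartbeats 800000 in
/-- ★ **Members of `T(p, I, q)` are nilpotent** when `I` consists of nilpotent matrices: the hull is block upper-triangular for the block sizes
`(p, 3, q)` with nilpotent diagonal blocks (`𝔫_p`, a member of `I`, `𝔫_q`). [memo §4 (ii) «conversely every such space is nilpotent»; this seat] -/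
theorem isNilpotent_of_mem_towerHull {p q : ℕ} (I : Submodule ℂ (Matrix (Fin 3) (Fin 3) ℂ)) (hI : ∀ X ∈ I, IsNilpotent X)
    (A : Matrix (Fin (p + 3 + q)) (Fin (p + 3 + q)) ℂ) (hA : A ∈ towerHull p q I) : IsNilpotent A := by
  classical
  obtain ⟨⟨h1, h2⟩, h3⟩ := mem_towerHull.1 hA
  -- levels `lvl = 2 − blk` make the hull block upper in the convention of `HeavyTopInvariantFlag`
  set lvl : Fin (p + 3 + q) → ℕ := fun i => 2 - blk p i with hlvl
  have hblk : ∀ i : Fin (p + 3 + q), blk p i ≤ 2 := fun i => by simp only [blk]; split_ifs <;> omega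
  have hup : ∀ i j, lvl i < lvl j → A i j = 0 := fun i j h => h1 i j (by simp only [hlvl] at h; have := hblk i; have := hblk j; omega)
  -- every diagonal block is nilpotent: exponent `K := p + 3 + q + 3`
  set K := p + 3 + q + 3 with hK
  have hdiag : ∀ t, (A.toBlock (fun i => lvl i = t) (fun i => lvl i = t)) ^ K = 0 := by
    intro t
    by_cases ht : t = 1
    · -- the middle block is `midBlock p q A ∈ I`, nilpotent
      subst ht
      obtain ⟨k, hk⟩ := hI _ h3
      have hk3 : (midBlock p q A) ^ 3 = 0 := pow_eq_zero_of_isNilpotent _ ⟨k, hk⟩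
      -- transfer along the reindexing `{lvl = 1} ≃ Fin 3`
      have hmem : ∀ i : {i : Fin (p + 3 + q) // lvl i = 1}, p ≤ ((i : Fin (p + 3 + q)) : ℕ) ∧ ((i : Fin (p + 3 + q)) : ℕ) < p + 3 := by
        rintro ⟨i, hi⟩
        simp only [hlvl, blk] at hi
        split_ifs at hi with ha hb <;> simp_all
      let e : {i : Fin (p + 3 + q) // lvl i = 1} ≃ Fin 3 :=
        { toFun := fun i => ⟨((i : Fin (p + 3 + q)) : ℕ) - p, by have := hmem i; omega⟩
          invFun := fun a => ⟨⟨p + (a : ℕ), by omega⟩, by simp only [hlvl, blk]; rw [if_neg (by omega), if_pos (by omega)]⟩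
          left_inv := fun i => by
            apply Subtype.ext; apply Fin.ext
            have := hmem i; dsimp only; omega
          right_inv := fun a => by apply Fin.ext; simp }
      have hre : Matrix.reindexAlgEquiv ℂ ℂ e (A.toBlock (fun i => lvl i = 1) (fun i => lvl i = 1)) = midBlock p q A := by
        ext a b; rfl
      have h0 : Matrix.reindexAlgEquiv ℂ ℂ e ((A.toBlock (fun i => lvl i = 1) (fun i => lvl i = 1)) ^ K) = 0 := by
        rw [map_pow, hre, show K = 3 + (p + q + 3) by omega, pow_add, hk3, zero_mul]
      have := congrArg (Matrix.reindexAlgEquiv ℂ ℂ e).symm h0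
      rwa [AlgEquiv.symm_apply_apply, map_zero] at this
    · -- an outer block (`t = 2`: first `p` indices; `t = 0`: last `q`) is strictly upper triangular for the index order
      have hsu : ∀ i j : {i : Fin (p + 3 + q) // lvl i = t},
          ((j : Fin (p + 3 + q)) : ℕ) ≤ ((i : Fin (p + 3 + q)) : ℕ) →
          (A.toBlock (fun i => lvl i = t) (fun i => lvl i = t)) i j = 0 := by
        rintro ⟨i, hi⟩ ⟨j, hj⟩ hji
        rw [Matrix.toBlock_apply]
        refine h2 i j ?_ ?_ hji
        · simp only [hlvl] at hi hj; have := hblk i; have := hblk j; omega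
        · intro hb; apply ht; simp only [hlvl] at hi; omega
      ext i j
      rw [Matrix.zero_apply]
      exact pow_apply_eq_zero_of_strictUpper_fun (fun i : {i : Fin (p + 3 + q) // lvl i = t} => ((i : Fin (p + 3 + q)) : ℕ)) _ hsu K i j
        (by have := (j : Fin (p + 3 + q)).isLt; omega)
  -- `C := A^K` is block upper with zero diagonal blocks, hence `C i j ≠ 0 ⇒ lvl j < lvl i`; then `C^3 = 0`
  have hupK : ∀ k, ∀ i j, lvl i < lvl j → (A ^ k) i j = 0 := by
    intro k; induction k with
    | zero => intro i j hij; rw [pow_zero, Matrix.one_apply, if_neg (fun h => by rw [h] at hij; exact lt_irrefl _ hij)]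
    | succ k ih => rw [pow_succ]; exact blockUpper_mul lvl _ _ ih hup
  have hC : ∀ i j, lvl i ≤ lvl j → (A ^ K) i j = 0 := by
    intro i j hij
    rcases hij.lt_or_eq with hlt | heq
    · exact hupK K i j hlt
    · have h := congr_fun (congr_fun ((toBlock_pow_of_blockUpper lvl A hup (lvl i) K).trans (hdiag (lvl i))) ⟨i, rfl⟩) ⟨j, heq.symm⟩
      rw [Matrix.toBlock_apply, Matrix.zero_apply] at h
      exact h
  refine ⟨K + K + K, ?_⟩
  rw [pow_add, pow_add]
  ext i j
  rw [Matrix.zero_apply, Matrix.mul_apply]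
  refine Finset.sum_eq_zero fun l _ => ?_
  rw [Matrix.mul_apply, Finset.sum_mul]
  refine Finset.sum_eq_zero fun k _ => ?_
  by_cases h1' : lvl i ≤ lvl k
  · rw [hC i k h1', zero_mul, zero_mul]
  by_cases h2' : lvl k ≤ lvl l
  · rw [hC k l h2', mul_zero, zero_mul]
  by_cases h3' : lvl l ≤ lvl j
  · rw [hC l j h3', mul_zero]
  exfalso
  have := hblk i; have := hblk j
  simp only [hlvl] at h1' h2' h3'
  omega

/-! ## Letters of the tower hull -/

/-- The matrix units `E_{ij}` of the free blocks (`blk i < blk j`) lie in the tower hull. -/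
theorem single_mem_towerHull {p q : ℕ} (I : Submodule ℂ (Matrix (Fin 3) (Fin 3) ℂ)) (i j : Fin (p + 3 + q)) (hij : blk p i < blk p j) :
    (Matrix.of fun a b : Fin (p + 3 + q) => if a = i ∧ b = j then (1 : ℂ) else 0) ∈ towerHull p q I := by
  refine mem_towerHull.2 ⟨⟨fun a b hab => ?_, fun a b hab _ _ => ?_⟩, ?_⟩
  · rw [Matrix.of_apply, if_neg]; rintro ⟨rfl, rfl⟩; omega
  · rw [Matrix.of_apply, if_neg]; rintro ⟨rfl, rfl⟩; omega
  · have e : midBlock p q (Matrix.of fun a b : Fin (p + 3 + q) => if a = i ∧ b = j then (1 : ℂ) else 0) = 0 := by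
      ext a b
      rw [midBlock_apply, Matrix.of_apply, Matrix.zero_apply, if_neg]
      rintro ⟨ha, hb⟩
      have h1 : blk p i = 1 := by rw [← ha]; simp only [blk]; rw [if_neg (by omega), if_pos (by omega)]
      have h2 : blk p j = 1 := by rw [← hb]; simp only [blk]; rw [if_neg (by omega), if_pos (by omega)]
      omega
    rw [e]; exact I.zero_mem

/-- The middle embedding `diag(0, X, 0)` of `X ∈ I` lies in the tower hull. -/
theorem middle_mem_towerHull {p q : ℕ} (I : Submodule ℂ (Matrix (Fin 3) (Fin 3) ℂ)) (X : Matrix (Fin 3) (Fin 3) ℂ) (hX : X ∈ I) :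
    (Matrix.of fun a b : Fin (p + 3 + q) =>
      if h : p ≤ (a : ℕ) ∧ (a : ℕ) < p + 3 ∧ p ≤ (b : ℕ) ∧ (b : ℕ) < p + 3 then X ⟨(a : ℕ) - p, by omega⟩ ⟨(b : ℕ) - p, by omega⟩ else 0) ∈
      towerHull p q I := by
  refine mem_towerHull.2 ⟨⟨fun a b hab => ?_, fun a b hab hne _ => ?_⟩, ?_⟩
  · rw [Matrix.of_apply, dif_neg]
    rintro ⟨h1, h2, h3, h4⟩
    simp only [blk, show ¬ ((a : ℕ) < p) by omega, h2, show ¬ ((b : ℕ) < p) by omega, h4, if_true, if_false] at hab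
    exact lt_irrefl _ hab
  · rw [Matrix.of_apply, dif_neg]
    rintro ⟨h1, h2, -, -⟩
    apply hne
    simp only [blk, show ¬ ((a : ℕ) < p) by omega, h2, if_true, if_false]
  · have e : midBlock p q (Matrix.of fun a b : Fin (p + 3 + q) =>
        if h : p ≤ (a : ℕ) ∧ (a : ℕ) < p + 3 ∧ p ≤ (b : ℕ) ∧ (b : ℕ) < p + 3 then X ⟨(a : ℕ) - p, by omega⟩ ⟨(b : ℕ) - p, by omega⟩ else 0) = X := by
      ext a b
      rw [midBlock_apply, Matrix.of_apply, dif_pos ⟨by simp, by simp, by simp, by simp⟩]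
      congr 1 <;> apply Fin.ext <;> simp
    rw [e]; exact hX

/-! ## The tower hull is not triangularisable -/

set_option maxHeartbeats 800000 in
/-- ★ **`T(p, I, q)` is not simultaneously strictly upper triangularisable** when `I` acts irreducibly on `ℂ³`: a conjugate inside `𝔫` would give an
invariant subspace `U` of dimension `p + 1`; the free blocks force `ℂ^p ⊆ U ⊆ ℂ^{p+3}`, and the middle part of `U` is then an `I`-invariant LINE in `ℂ³`.
[memo §4 (ii) «a tower is not triangularisable since I is not»; this seat] -/
theorem not_strictUpper_conj_towerHull {p q : ℕ} (I : Submodule ℂ (Matrix (Fin 3) (Fin 3) ℂ))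
    (hirr : ∀ U : Submodule ℂ (Fin 3 → ℂ), (∀ X ∈ I, ∀ x ∈ U, X *ᵥ x ∈ U) → U = ⊥ ∨ U = ⊤) :
    ¬ ∃ P : Matrix (Fin (p + 3 + q)) (Fin (p + 3 + q)) ℂ, IsUnit P ∧
      ∀ A ∈ towerHull p q I, Literature.LinearAlgebra.Matrix.IsStrictUpper (P * A * P⁻¹) := by
  classical
  rintro ⟨P, hP, hsu⟩
  have hPdet : IsUnit P.det := (Matrix.isUnit_iff_isUnit_det P).1 hP
  -- the invariant subspace `U := P⁻¹ · span(e_0, …, e_p)` of dimension `p + 1`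
  set F : Submodule ℂ (Fin (p + 3 + q) → ℂ) := Submodule.span ℂ (Set.range fun k : Fin (p + 1) => (Pi.single (⟨(k : ℕ), by omega⟩ : Fin (p + 3 + q)) (1 : ℂ) : Fin (p + 3 + q) → ℂ))
    with hF
  set U : Submodule ℂ (Fin (p + 3 + q) → ℂ) := F.map (Matrix.toLin' P⁻¹) with hU
  have hFvan : ∀ x ∈ F, ∀ a : Fin (p + 3 + q), p + 1 ≤ (a : ℕ) → x a = 0 := by
    intro x hx a ha
    induction hx using Submodule.span_induction with
    | mem y hy =>
      obtain ⟨k, rfl⟩ := hy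
      dsimp only
      rw [Pi.single_apply, if_neg]; intro h; rw [Fin.ext_iff] at h; simp at h; omega
    | zero => rfl
    | add y z _ _ hy hz => rw [Pi.add_apply, hy, hz, add_zero]
    | smul t y _ hy => rw [Pi.smul_apply, hy, smul_zero]
  have hFmem : ∀ x : Fin (p + 3 + q) → ℂ, (∀ a : Fin (p + 3 + q), p + 1 ≤ (a : ℕ) → x a = 0) → x ∈ F := by
    intro x hx
    have hxe : x = ∑ k : Fin (p + 1), x ⟨(k : ℕ), by omega⟩ • (Pi.single (⟨(k : ℕ), by omega⟩ : Fin (p + 3 + q)) (1 : ℂ) : Fin (p + 3 + q) → ℂ) := by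
      funext a
      rw [Finset.sum_apply]
      simp only [Pi.smul_apply, Pi.single_apply, smul_eq_mul, mul_ite, mul_one, mul_zero]
      by_cases ha : p + 1 ≤ (a : ℕ)
      · rw [hx a ha]; symm
        exact Finset.sum_eq_zero fun k _ => if_neg (fun h => by rw [Fin.ext_iff] at h; simp at h; omega)
      · rw [Finset.sum_eq_single ⟨(a : ℕ), by omega⟩]
        · rw [if_pos (Fin.ext rfl)]
        · intro k _ hk; rw [if_neg]; intro h; apply hk; rw [Fin.ext_iff] at h ⊢; simp at h ⊢; omega
        · intro h; exact absurd (Finset.mem_univ _) h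
    rw [hxe]; exact F.sum_mem fun k _ => F.smul_mem _ (Submodule.subset_span ⟨k, rfl⟩)
  -- `U` is invariant under every member of the hull
  have hUinv : ∀ A ∈ towerHull p q I, ∀ u ∈ U, A *ᵥ u ∈ U := by
    intro A hA u hu
    obtain ⟨x, hx, rfl⟩ := Submodule.mem_map.1 hu
    rw [Matrix.toLin'_apply]
    refine Submodule.mem_map.2 ⟨(P * A * P⁻¹) *ᵥ x, hFmem _ (fun a ha => ?_), ?_⟩
    · rw [Matrix.mulVec, dotProduct]
      refine Finset.sum_eq_zero fun b _ => ?_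
      by_cases hb : p + 1 ≤ (b : ℕ)
      · rw [hFvan x hx b hb, mul_zero]
      · rw [hsu A hA a b (Fin.le_def.2 (by omega)), zero_mul]
    · rw [Matrix.toLin'_apply, Matrix.mulVec_mulVec, Matrix.mulVec_mulVec, ← Matrix.mul_assoc, ← Matrix.mul_assoc,
        Matrix.nonsing_inv_mul P hPdet, Matrix.one_mul]
  -- free blocks: a vector of `U` with a non-zero coordinate `≥ p` puts `e_i ∈ U` for every `i < p`; one with a coordinate `≥ p + 3` puts `e_i ∈ U` for `i < p + 3`
  have hpull : ∀ u ∈ U, ∀ j : Fin (p + 3 + q), u j ≠ 0 → ∀ i : Fin (p + 3 + q), blk p i < blk p j → (Pi.single i (1 : ℂ) : Fin (p + 3 + q) → ℂ) ∈ U := by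
    intro u hu j hj i hij
    have h := hUinv _ (single_mem_towerHull I i j hij) u hu
    have e : (Matrix.of fun a b : Fin (p + 3 + q) => if a = i ∧ b = j then (1 : ℂ) else 0) *ᵥ u = u j • (Pi.single i (1 : ℂ) : Fin (p + 3 + q) → ℂ) := by
      funext a
      rw [Matrix.mulVec, dotProduct, Pi.smul_apply, Pi.single_apply, smul_eq_mul]
      by_cases ha : a = i
      · subst ha
        rw [if_pos rfl, mul_one, Finset.sum_eq_single j]
        · rw [Matrix.of_apply, if_pos ⟨rfl, rfl⟩, one_mul]
        · intro b _ hb; rw [Matrix.of_apply, if_neg (fun h => hb h.2), zero_mul]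
        · intro h; exact absurd (Finset.mem_univ _) h
      · rw [if_neg ha, mul_zero]
        exact Finset.sum_eq_zero fun b _ => by rw [Matrix.of_apply, if_neg (fun h => ha h.1), zero_mul]
    rw [e] at h
    have := U.smul_mem (u j)⁻¹ h
    rwa [smul_smul, inv_mul_cancel₀ hj, one_smul] at this
  -- dimension of `U`
  have hUdim : Module.finrank ℂ U = p + 1 := by
    have hinj : Function.Injective (Matrix.toLin' P⁻¹) := by
      rw [← LinearMap.ker_eq_bot, LinearMap.ker_eq_bot']
      intro x hx
      rw [Matrix.toLin'_apply] at hx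
      have := congrArg (fun y => P *ᵥ y) hx
      simpa [Matrix.mulVec_mulVec, Matrix.mul_nonsing_inv P hPdet] using this
    rw [hU, ← (Submodule.equivMapOfInjective _ hinj F).finrank_eq]
    have hli : LinearIndependent ℂ (fun k : Fin (p + 1) => (Pi.single (⟨(k : ℕ), by omega⟩ : Fin (p + 3 + q)) (1 : ℂ) : Fin (p + 3 + q) → ℂ)) := by
      have h := (Pi.basisFun ℂ (Fin (p + 3 + q))).linearIndependent
      have h2 := h.comp (fun k : Fin (p + 1) => (⟨(k : ℕ), by omega⟩ : Fin (p + 3 + q))) (fun a b hab => by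
        rw [Fin.ext_iff] at hab; exact Fin.ext (by simpa using hab))
      convert h2 using 1
      funext k; simp [Pi.basisFun_apply]
    rw [hF, finrank_span_eq_card hli, Fintype.card_fin]
  -- `U ⊄ ℂ^p`: some `u ∈ U` has a non-zero coordinate `≥ p`, whence `ℂ^p ⊆ U`
  have hCp : ∀ i : Fin (p + 3 + q), (i : ℕ) < p → (Pi.single i (1 : ℂ) : Fin (p + 3 + q) → ℂ) ∈ U := by
    by_contra hcon
    push Not at hcon
    obtain ⟨i₀, hi₀, hi₀U⟩ := hcon
    -- then every `u ∈ U` is supported on `[0, p)`, so `dim U ≤ p`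
    have hsupp : ∀ u ∈ U, ∀ j : Fin (p + 3 + q), p ≤ (j : ℕ) → u j = 0 := by
      intro u hu j hj
      by_contra hne
      exact hi₀U (hpull u hu j hne i₀ (by simp only [blk]; rw [if_pos hi₀]; split_ifs <;> omega))
    have hle : U ≤ Submodule.span ℂ (Set.range fun k : Fin p => (Pi.single (⟨(k : ℕ), by omega⟩ : Fin (p + 3 + q)) (1 : ℂ) : Fin (p + 3 + q) → ℂ)) := by
      intro u hu
      have hue : u = ∑ k : Fin p, u ⟨(k : ℕ), by omega⟩ • (Pi.single (⟨(k : ℕ), by omega⟩ : Fin (p + 3 + q)) (1 : ℂ) : Fin (p + 3 + q) → ℂ) := by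
        funext a
        rw [Finset.sum_apply]
        simp only [Pi.smul_apply, Pi.single_apply, smul_eq_mul, mul_ite, mul_one, mul_zero]
        by_cases ha : p ≤ (a : ℕ)
        · rw [hsupp u hu a ha]; symm
          exact Finset.sum_eq_zero fun k _ => if_neg (fun h => by rw [Fin.ext_iff] at h; simp at h; omega)
        · rw [Finset.sum_eq_single ⟨(a : ℕ), by omega⟩]
          · rw [if_pos (Fin.ext rfl)]
          · intro k _ hk; rw [if_neg]; intro h; apply hk; rw [Fin.ext_iff] at h ⊢; simp at h ⊢; omega
          · intro h; exact absurd (Finset.mem_univ _) h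
      rw [hue]
      exact Submodule.sum_mem _ fun k _ => Submodule.smul_mem _ _ (Submodule.subset_span ⟨k, rfl⟩)
    have h1 := Submodule.finrank_mono hle
    have h2 : Module.finrank ℂ (Submodule.span ℂ (Set.range fun k : Fin p => (Pi.single (⟨(k : ℕ), by omega⟩ : Fin (p + 3 + q)) (1 : ℂ) : Fin (p + 3 + q) → ℂ))) ≤ p := by
      have := finrank_span_le_card (R := ℂ) (Set.range fun k : Fin p => (Pi.single (⟨(k : ℕ), by omega⟩ : Fin (p + 3 + q)) (1 : ℂ) : Fin (p + 3 + q) → ℂ))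
      rw [Set.toFinset_range] at this
      exact this.trans ((Finset.card_image_le).trans (by simp))
    omega
  -- no `u ∈ U` has a non-zero coordinate `≥ p + 3` (else `dim U ≥ p + 3`)
  have htail : ∀ u ∈ U, ∀ j : Fin (p + 3 + q), p + 3 ≤ (j : ℕ) → u j = 0 := by
    intro u hu j hj
    by_contra hne
    have hall : ∀ i : Fin (p + 3 + q), (i : ℕ) < p + 3 → (Pi.single i (1 : ℂ) : Fin (p + 3 + q) → ℂ) ∈ U := fun i hi =>
      hpull u hu j hne i (by simp only [blk]; rw [if_neg (show ¬ ((j : ℕ) < p) by omega), if_neg (show ¬ ((j : ℕ) < p + 3) by omega)]; split_ifs <;> omega)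
    have hle : Submodule.span ℂ (Set.range fun k : Fin (p + 3) => (Pi.single (⟨(k : ℕ), by omega⟩ : Fin (p + 3 + q)) (1 : ℂ) : Fin (p + 3 + q) → ℂ)) ≤ U := by
      rw [Submodule.span_le]; rintro _ ⟨k, rfl⟩; exact hall _ (by simp)
    have hli : LinearIndependent ℂ (fun k : Fin (p + 3) => (Pi.single (⟨(k : ℕ), by omega⟩ : Fin (p + 3 + q)) (1 : ℂ) : Fin (p + 3 + q) → ℂ)) := by
      have h := (Pi.basisFun ℂ (Fin (p + 3 + q))).linearIndependent
      have h2 := h.comp (fun k : Fin (p + 3) => (⟨(k : ℕ), by omega⟩ : Fin (p + 3 + q))) (fun a b hab => by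
        rw [Fin.ext_iff] at hab; exact Fin.ext (by simpa using hab))
      convert h2 using 1
      funext k; simp [Pi.basisFun_apply]
    have h1 := Submodule.finrank_mono hle
    rw [finrank_span_eq_card hli, Fintype.card_fin] at h1
    omega
  -- the middle projection of `U` is an `I`-invariant LINE in `ℂ³`
  let π : (Fin (p + 3 + q) → ℂ) →ₗ[ℂ] (Fin 3 → ℂ) := LinearMap.pi fun a : Fin 3 => LinearMap.proj (⟨p + (a : ℕ), by omega⟩ : Fin (p + 3 + q))
  have hπ : ∀ u (a : Fin 3), π u a = u ⟨p + (a : ℕ), by omega⟩ := fun u a => rfl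
  set U' : Submodule ℂ (Fin 3 → ℂ) := U.map π with hU'
  have hU'inv : ∀ X ∈ I, ∀ y ∈ U', X *ᵥ y ∈ U' := by
    intro X hX y hy
    obtain ⟨u, hu, rfl⟩ := Submodule.mem_map.1 hy
    refine Submodule.mem_map.2 ⟨_, hUinv _ (middle_mem_towerHull I X hX) u hu, ?_⟩
    funext a
    rw [hπ, Matrix.mulVec, dotProduct, Matrix.mulVec, dotProduct]
    -- the sum over `Fin (p + 3 + q)` reduces to the three middle coordinates
    rw [← Finset.sum_subset (Finset.subset_univ ((Finset.univ : Finset (Fin 3)).image fun b : Fin 3 => (⟨p + (b : ℕ), by omega⟩ : Fin (p + 3 + q))))]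
    · rw [Finset.sum_image (fun b _ b' _ h => by rw [Fin.ext_iff] at h; exact Fin.ext (by simpa using h))]
      refine Finset.sum_congr rfl fun b _ => ?_
      rw [Matrix.of_apply, dif_pos ⟨by simp, by simp, by simp, by simp⟩, hπ]
      congr 2 <;> apply Fin.ext <;> simp
    · intro c _ hc
      rw [Matrix.of_apply, dif_neg, zero_mul]
      rintro ⟨-, -, h3, h4⟩
      apply hc
      rw [Finset.mem_image]
      exact ⟨⟨(c : ℕ) - p, by omega⟩, Finset.mem_univ _, Fin.ext (by simp; omega)⟩
  -- `U' ≠ ⊥`: pick `u ∈ U` outside `ℂ^p`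
  have hU'ne : U' ≠ ⊥ := by
    intro hbot
    -- then `U ≤ ℂ^p`, contradicting `dim U = p + 1`
    have hsupp : ∀ u ∈ U, ∀ j : Fin (p + 3 + q), p ≤ (j : ℕ) → u j = 0 := by
      intro u hu j hj
      by_cases hj3 : p + 3 ≤ (j : ℕ)
      · exact htail u hu j hj3
      · have h0 : π u = 0 := by
          have : π u ∈ U' := Submodule.mem_map_of_mem hu
          rwa [hbot, Submodule.mem_bot] at this
        have := congr_fun h0 ⟨(j : ℕ) - p, by omega⟩
        rw [hπ, Pi.zero_apply] at this
        convert this using 2; apply Fin.ext; simp; omega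
    have hle : U ≤ Submodule.span ℂ (Set.range fun k : Fin p => (Pi.single (⟨(k : ℕ), by omega⟩ : Fin (p + 3 + q)) (1 : ℂ) : Fin (p + 3 + q) → ℂ)) := by
      intro u hu
      have hue : u = ∑ k : Fin p, u ⟨(k : ℕ), by omega⟩ • (Pi.single (⟨(k : ℕ), by omega⟩ : Fin (p + 3 + q)) (1 : ℂ) : Fin (p + 3 + q) → ℂ) := by
        funext a
        rw [Finset.sum_apply]
        simp only [Pi.smul_apply, Pi.single_apply, smul_eq_mul, mul_ite, mul_one, mul_zero]
        by_cases ha : p ≤ (a : ℕ)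
        · rw [hsupp u hu a ha]; symm
          exact Finset.sum_eq_zero fun k _ => if_neg (fun h => by rw [Fin.ext_iff] at h; simp at h; omega)
        · rw [Finset.sum_eq_single ⟨(a : ℕ), by omega⟩]
          · rw [if_pos (Fin.ext rfl)]
          · intro k _ hk; rw [if_neg]; intro h; apply hk; rw [Fin.ext_iff] at h ⊢; simp at h ⊢; omega
          · intro h; exact absurd (Finset.mem_univ _) h
      rw [hue]
      exact Submodule.sum_mem _ fun k _ => Submodule.smul_mem _ _ (Submodule.subset_span ⟨k, rfl⟩)
    have h1 := Submodule.finrank_mono hle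
    have h2 : Module.finrank ℂ (Submodule.span ℂ (Set.range fun k : Fin p => (Pi.single (⟨(k : ℕ), by omega⟩ : Fin (p + 3 + q)) (1 : ℂ) : Fin (p + 3 + q) → ℂ))) ≤ p := by
      have := finrank_span_le_card (R := ℂ) (Set.range fun k : Fin p => (Pi.single (⟨(k : ℕ), by omega⟩ : Fin (p + 3 + q)) (1 : ℂ) : Fin (p + 3 + q) → ℂ))
      rw [Set.toFinset_range] at this
      exact this.trans ((Finset.card_image_le).trans (by simp))
    omega
  -- `U' ≠ ⊤`: `dim U' = dim U − dim (U ⊓ ker π) ≤ (p + 1) − p = 1 < 3`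
  have hU'lt : U' ≠ ⊤ := by
    intro htop
    have hrn := LinearMap.finrank_range_add_finrank_ker (π.domRestrict U)
    rw [LinearMap.range_domRestrict, LinearMap.ker_domRestrict] at hrn
    have hker : p ≤ Module.finrank ℂ ((LinearMap.ker π).comap U.subtype) := by
      rw [← Submodule.finrank_map_subtype_eq U ((LinearMap.ker π).comap U.subtype), Submodule.map_comap_subtype]
      have hle : Submodule.span ℂ (Set.range fun k : Fin p => (Pi.single (⟨(k : ℕ), by omega⟩ : Fin (p + 3 + q)) (1 : ℂ) : Fin (p + 3 + q) → ℂ)) ≤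
          U ⊓ LinearMap.ker π := by
        rw [Submodule.span_le]
        rintro _ ⟨k, rfl⟩
        refine ⟨hCp _ (by simp), ?_⟩
        rw [SetLike.mem_coe, LinearMap.mem_ker]
        funext a; rw [hπ]; dsimp only; rw [Pi.single_apply, if_neg, Pi.zero_apply]
        intro h; rw [Fin.ext_iff] at h; simp at h; omega
      have hli : LinearIndependent ℂ (fun k : Fin p => (Pi.single (⟨(k : ℕ), by omega⟩ : Fin (p + 3 + q)) (1 : ℂ) : Fin (p + 3 + q) → ℂ)) := by
        have h := (Pi.basisFun ℂ (Fin (p + 3 + q))).linearIndependent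
        have h2 := h.comp (fun k : Fin p => (⟨(k : ℕ), by omega⟩ : Fin (p + 3 + q))) (fun a b hab => by
          rw [Fin.ext_iff] at hab; exact Fin.ext (by simpa using hab))
        convert h2 using 1
        funext k; simp [Pi.basisFun_apply]
      have h1 := Submodule.finrank_mono hle
      rw [finrank_span_eq_card hli, Fintype.card_fin] at h1
      exact h1
    have htop' : Module.finrank ℂ (U.map π) = 3 := by
      rw [← hU', htop, finrank_top, Module.finrank_fin_fun]
    rw [htop', hUdim] at hrn
    omega
  exact absurd (hirr U' hU'inv) (by push Not; exact ⟨hU'ne, hU'lt⟩)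

end Summit.ValiantsHypothesis.ValiantsHypothesis.Theorems.GrenetZeon.HeavyTopTowerLemmas

end
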